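import Summits.BirchSwinnertonDyer.BirchSwinnertonDyer.Theorems.ErratumRoadFiveOpenInputNotRamStubCharTorsionNotRam
import Summits.BirchSwinnertonDyer.BirchSwinnertonDyer.Theorems.ErratumRoadFiveControlOfFacts
import HarnessLib

/-!
# Route `ErratumRoadFive` (rung K2), crux `OpenInputNotRam` (item 19282), registered stub CTL₀ `stub_charTorsionNotRam` of
# `Cruxes/OpenInputNotRam/Lines/birth.lean` — discharged from GZK, modularity and the two Poitou–Tate facts, WITHOUT the
# Jetchev–Skinner–Wan fact (cell `bsd-stepL`, seat `bsd-stepL-imc-p1` g16; `--supports stmt-BirchSwinnertonDyer-19282`; Theses-free)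

bdp's `openInputNotRam_stub_charTorsionNotRam_of_thm331Mult` (`Theorems/ErratumRoadFiveOpenInputNotRamStubCharTorsionNotRam.lean`)
proves the registered stub's statement from `thm331_anticyclotomicControl_mult` (item 19626) + Kolyvagin. Here the same statement
from the four cited facts `rank_eq_analyticRank_of_analyticRank_le_one`, `exists_isNewformOf`, `poitouTate_selmerStructure_duality`,
`poitouTate_sha_tateDual` (conjuncts 2, 4, 13, 14 of support 19283), by `p2ControlOnTree_odd_of_facts`
(`Theorems/ErratumRoadFiveControlOfFacts.lean`: the tree's kernel control theorem). Drop-in twin with `(h, hKo) ↦ (hGZK, hnf, hPT, hPT2)`.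

HONEST FRAMING: theorems only (no definition, no named fact, no `sorry`); CONDITIONAL on the four cited facts; the stub's own
fact-free signature is not claimed; item 19282 stays open; BSD is proved for no pair; no count moves (T7).
-/

set_option autoImplicit false
set_option linter.dupNamespace false

noncomputable section

open scoped Classical

open WeierstrassCurve NumberField IsDedekindDomain Literature.NumberTheory.EllipticCurves
  Literature.NumberTheory.EllipticCurves.ModularForms
  Literature.NumberTheory.EllipticCurves.Rank1Residual Literature.NumberTheory.GaloisCohomology
  Summit.BirchSwinnertonDyer.Rank1Residual Summit.BirchSwinnertonDyer.Rank1Residual.X11b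
  Summit.BirchSwinnertonDyer.Rank1Residual.X11b.AcSelmer Summit.BirchSwinnertonDyer.Rank1Residual.X11b.Halves

namespace Summit.BirchSwinnertonDyer.BirchSwinnertonDyer.Theorems

/-- **Stub CTL₀ of crux `OpenInputNotRam` (item 19282) from the four cited facts — NO Jetchev–Skinner–Wan fact, NO Kolyvagin over `K`.**
At every datum of the stub (¬(ram) X11b pair, `p ≥ 5`, `ρ̄` onto, odd-`d_K` Manin-good Heegner datum with non-torsion Heegner point,
anticyclotomic `κ`, `γ`, degree-one `𝔭 ∋ p`): `∃ n, XAc.HasCharValuationAt (W.baseChange K) p κ 𝔭 ∅ γ n` — the first conjunct of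
`ControlOnTreeAt p κ 𝔭 γ (embAt K p 𝔭) P` (`p2ControlOnTree_odd_of_facts`, then `Halves.exists_hasCharValuationAt_of_controlOnTreeAt`).
The binders `¬ Ram W p`, `5 ≤ p` are idle. CONDITIONAL on the four cited facts; nothing booked.
[cite: JetchevSkinnerWan2017, Thm. 3.3.1 with §3.5 (3.5.c) (arXiv:1512.06894 pp. 11, 15)]
[cite: Castella2018, Thm. 2.3 (arXiv:1704.06608 p. 5) (shape)] [cite: MilneADT2006, Ch. I, Thm. 4.10 and Thm. 2.8] -/
theorem openInputNotRam_stub_charTorsionNotRam_of_facts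
    (hGZK : rank_eq_analyticRank_of_analyticRank_le_one) (hnf : exists_isNewformOf)
    (hPT : ∀ (K : Type) [Field K] [NumberField K], poitouTate_selmerStructure_duality K)
    (hPT2 : ∀ (K : Type) [Field K] [NumberField K], poitouTate_sha_tateDual K) :
    ∀ (W : WeierstrassCurve ℚ) [W.IsElliptic] [W.IsGloballyMinimal] (p : ℕ) [Fact p.Prime]
      (N : ℕ) [NeZero N] (K : Type) [Field K] [NumberField K]
      (Dt : ModularParametrizationData W N) (H : HeegnerDatum N (NumberField.discr K)) (ι : K →+* ℂ)
      (P : (W.baseChange K).toAffine.Point),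
      ¬ Literature.NumberTheory.EllipticCurves.Rank1Residual.Ram W p →
      ClassX11b W p → 5 ≤ p → Surj W p → W.conductorNorm ℤ = N → IsImaginaryQuadratic K →
      Odd (NumberField.discr K) → ¬ (p : ℤ) ∣ NumberField.discr K → ¬ p ∣ Units.torsionOrder K →
      SatisfiesHeegnerHypothesis N K →
      (W.quadraticTwist (NumberField.discr K : ℚ)).entireLFunction 1 ≠ 0 →
      WeierstrassCurve.Affine.Point.map ι.toRatAlgHom P = heegnerPointComplex Dt H →
      ¬ (p : ℤ) ∣ Dt.c → ¬ IsOfFinAddOrder P →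
      ∀ (κ : ZpExtension K p), κ.IsAnticyclotomic →
        ∀ (γ : Field.absoluteGaloisGroup K) [Fact (κ.IsTopGenerator γ)]
          (𝔭 : HeightOneSpectrum (𝓞 K)), ((p : ℕ) : 𝓞 K) ∈ 𝔭.asIdeal →
          𝔭.asIdeal.ramificationIdx (𝓞 ℚ) = 1 → 𝔭.asIdeal.inertiaDeg (𝓞 ℚ) = 1 →
          ∃ n : ℕ, XAc.HasCharValuationAt (W.baseChange K) p κ 𝔭 ∅ γ n := by
  intro W _ _ p _ N _ K _ _ Dt H ι P _hnr hX _hp5 hsurj hN hK hodd hdisc htor hheeg hL1 hP hc hP0 κ hκ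
    γ _ 𝔭 h𝔭 he hf
  exact exists_hasCharValuationAt_of_controlOnTreeAt W p (embAt K p 𝔭 h𝔭 he hf) P κ 𝔭 γ
    (p2ControlOnTree_odd_of_facts W p hGZK hnf hPT hPT2 N K Dt H ι P hX hsurj hN hK hodd hdisc htor hheeg
      hL1 hP hc hP0 κ hκ γ 𝔭 h𝔭 he hf)

end Summit.BirchSwinnertonDyer.BirchSwinnertonDyer.Theorems

end
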